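import Literature.NumberTheory.GaloisRepresentations.LocalGaloisGroupHenselProofs
import Literature.NumberTheory.GaloisRepresentations.LocalGaloisGroupProofs
import Literature.NumberTheory.GaloisRepresentations.WeilGroup
import Literature.NumberTheory.GaloisRepresentations.AbsGaloisGroup
import Mathlib.FieldTheory.KrullTopology
import HarnessLib

/-!
# Transport of the local Galois data along a semilinear automorphism of `Ē`
# ([AbsAnab] Prop 1.2.1 (iv) input `mlf_reciprocity_equivariant`, step 1)

S. Mochizuki, *The Absolute Anabelian Geometry of Hyperbolic Curves* (2004) [AbsAnab], §1.2,
proof of Prop 1.2.1 (iv), p. 11: the reciprocity map `E^× → G_E^{ab}` of a finite Galois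
subextension `E` of an MLF `K` is compatible with the action of `G_K` — on `E` through
`Gal(E/K)` and on `G_E ⊴ G_K` by conjugation (functoriality of the norm residue symbol under
isomorphisms of fields, Neukirch, *Algebraic Number Theory* IV (5.8)).  The tree's reciprocity map
lives on `Ē = AlgebraicClosure E`; an element `g ∈ G_K` acts on `Ē` (through a chosen
`E`-isomorphism `K̄ ≅ Ē`) by a RING automorphism `φ` which is `γ`-SEMILINEAR for the field
automorphism `γ = g|_E` of `E`: `φ (algebraMap E Ē x) = algebraMap E Ē (γ x)`, and `γ` preserves
the valuation of the local field `E`.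

This proof-only file transports the local data of `LocalGaloisGroup.lean` along such a pair
`(γ, φ)`:

* `map_mem_integer_iff`, `map_mem_absIntegers`: `γ 𝒪_E = 𝒪_E`, `φ S = S` (`S = absIntegers`);
* `eq_absMaximalIdeal_of_isMaximal`: `𝔓 = absMaximalIdeal E` is the ONLY maximal ideal of `S`
  (henselianity: `primesOver_maximalIdeal_eq_singleton_holds`), hence `map_mem_absMaximalIdeal`:
  `φ 𝔓 = 𝔓`;
* `isFrobPow_of_semilinear_conj`: if `σ' ∘ φ = φ ∘ σ` on `Ē` then `IsFrobPow σ n → IsFrobPow σ' n`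
  (so conjugation by `φ` preserves inertia, Weil group and degree);
* `exists_continuousMulEquiv_semilinear_conj`: conjugation by `φ` IS a topological automorphism
  `c` of `G_E = Gal(Ē/E)` with `c σ ∘ φ = φ ∘ σ` (Krull continuity as in
  `Literature.FieldTheory.Galois.FixingSubgroupAbsoluteGalois`).

No definitions.  References: Neukirch, *ANT* IV (5.8); Serre, *Local Fields* II §2 Prop. 3.
-/

noncomputable section

open Field ValuativeRel Polynomial
open scoped Pointwise Topology

namespace Literature.AnabelianGeometry.AbsoluteAnabelian

open Literature.NumberTheory.GaloisRepresentations
open Literature.NumberTheory.GaloisRepresentations.IsNonarchimedeanLocalField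

universe u

section Valued

variable {E : Type u} [Field E] [ValuativeRel E] [TopologicalSpace E] [IsNonarchimedeanLocalField E]

/-! ### `γ` preserves the valuation ring; `φ` preserves the absolute integers -/

omit [TopologicalSpace E] [IsNonarchimedeanLocalField E] in
/-- A valuation-preserving automorphism `γ` of `E` preserves `𝒪_E`.
[cite: NeukirchANT1999, Ch. IV Prop. (5.8)] -/
theorem map_mem_integer_iff {γ : E ≃+* E} (hγ : ∀ x, valuation E (γ x) = valuation E x) (x : E) :
    γ x ∈ 𝒪[E] ↔ x ∈ 𝒪[E] := by
  rw [Valuation.mem_integer_iff, Valuation.mem_integer_iff, hγ]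

omit [TopologicalSpace E] [IsNonarchimedeanLocalField E] in
/-- `φ` (`γ`-semilinear, `γ` valuation-preserving) maps the absolute integers
`S = absIntegers 𝒪_E E` (integral closure of `𝒪_E` in `Ē`) into themselves: a monic relation
`p(y) = 0` over `𝒪_E` gives `(γ p)(φ y) = 0`. [cite: NeukirchANT1999, Ch. IV Prop. (5.8)] -/
theorem map_mem_absIntegers {γ : E ≃+* E} (hγ : ∀ x, valuation E (γ x) = valuation E x)
    {φ : AlgebraicClosure E ≃+* AlgebraicClosure E}
    (hφ : ∀ x : E, φ (algebraMap E (AlgebraicClosure E) x) = algebraMap E (AlgebraicClosure E) (γ x))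
    {y : AlgebraicClosure E} (hy : y ∈ absIntegers 𝒪[E] E) :
    φ y ∈ absIntegers 𝒪[E] E := by
  rw [mem_integralClosure_iff] at hy ⊢
  obtain ⟨p, hp, hpy⟩ := hy
  have hγO : ∀ r : 𝒪[E], γ (r : E) ∈ 𝒪[E] := fun r => (map_mem_integer_iff hγ (r : E)).mpr r.2
  let γ₀ : 𝒪[E] →+* 𝒪[E] :=
    { toFun := fun r => ⟨γ (r : E), hγO r⟩
      map_one' := Subtype.ext (map_one γ)
      map_mul' := fun a b => Subtype.ext (map_mul γ (a : E) (b : E))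
      map_zero' := Subtype.ext (map_zero γ)
      map_add' := fun a b => Subtype.ext (map_add γ (a : E) (b : E)) }
  refine ⟨p.map γ₀, hp.map γ₀, ?_⟩
  have hcomp : (algebraMap 𝒪[E] (AlgebraicClosure E)).comp γ₀ =
      φ.toRingHom.comp (algebraMap 𝒪[E] (AlgebraicClosure E)) := by
    ext r
    change algebraMap 𝒪[E] (AlgebraicClosure E) ⟨γ (r : E), _⟩ =
      φ (algebraMap 𝒪[E] (AlgebraicClosure E) r)
    rw [IsScalarTower.algebraMap_apply 𝒪[E] E (AlgebraicClosure E),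
      IsScalarTower.algebraMap_apply 𝒪[E] E (AlgebraicClosure E), hφ]
    rfl
  rw [eval₂_map, hcomp]
  change eval₂ (φ.toRingHom.comp _) (φ.toRingHom y) p = 0
  rw [← hom_eval₂, hpy, map_zero]

/-! ### `𝔓` is the only maximal ideal of `S`; `φ` preserves it -/

/-- **`𝔓 = absMaximalIdeal E` is the unique maximal ideal of `S = absIntegers 𝒪_E E`**: a maximal
ideal of the integral extension `S ⊇ 𝒪_E` lies over the maximal ideal `𝓂_E` of the local ring
`𝒪_E`, and `𝔓` is the only prime of `S` over `𝓂_E` (`E` henselian,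
`primesOver_maximalIdeal_eq_singleton_holds`). [cite: SerreLocalFields1979, Ch. II §2 Prop. 3] -/
theorem eq_absMaximalIdeal_of_isMaximal (M : Ideal (absIntegers 𝒪[E] E)) [hM : M.IsMaximal] :
    M = absMaximalIdeal E := by
  have hunder : M.under 𝒪[E] = 𝓂[E] := IsLocalRing.eq_maximalIdeal inferInstance
  have hmem : M ∈ (𝓂[E]).primesOver (absIntegers 𝒪[E] E) :=
    ⟨hM.isPrime, ⟨hunder.symm⟩⟩
  rw [primesOver_maximalIdeal_eq_singleton_holds E] at hmem
  exact hmem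

/-- `φ` maps `𝔓` into `𝔓`: the image of `𝔓` under the ring automorphism of `S` induced by `φ`
is a maximal ideal, hence `𝔓`. [cite: SerreLocalFields1979, Ch. II §2 Prop. 3] -/
theorem map_mem_absMaximalIdeal {φ : AlgebraicClosure E ≃+* AlgebraicClosure E}
    (hS : ∀ y ∈ absIntegers 𝒪[E] E, φ y ∈ absIntegers 𝒪[E] E)
    (hS' : ∀ y ∈ absIntegers 𝒪[E] E, φ.symm y ∈ absIntegers 𝒪[E] E)
    (y : absIntegers 𝒪[E] E) (hy : y ∈ absMaximalIdeal E) :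
    (⟨φ (y : AlgebraicClosure E), hS _ y.2⟩ : absIntegers 𝒪[E] E) ∈ absMaximalIdeal E := by
  let ψ : absIntegers 𝒪[E] E ≃+* absIntegers 𝒪[E] E :=
    { toFun := fun z => ⟨φ (z : AlgebraicClosure E), hS _ z.2⟩
      invFun := fun z => ⟨φ.symm (z : AlgebraicClosure E), hS' _ z.2⟩
      left_inv := fun z => Subtype.ext (φ.symm_apply_apply (z : AlgebraicClosure E))
      right_inv := fun z => Subtype.ext (φ.apply_symm_apply (z : AlgebraicClosure E))
      map_mul' := fun a b => Subtype.ext (map_mul φ (a : AlgebraicClosure E) (b : AlgebraicClosure E))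
      map_add' := fun a b => Subtype.ext (map_add φ (a : AlgebraicClosure E) (b : AlgebraicClosure E)) }
  haveI : (absMaximalIdeal E).IsMaximal := absMaximalIdeal_isMaximal_holds E
  haveI : ((absMaximalIdeal E).map ψ).IsMaximal := Ideal.map_isMaximal_of_equiv ψ
  have heq : (absMaximalIdeal E).map ψ = absMaximalIdeal E := eq_absMaximalIdeal_of_isMaximal _
  have : ψ y ∈ (absMaximalIdeal E).map ψ := Ideal.mem_map_of_mem ψ hy
  rwa [heq] at this

/-! ### Frobenius powers under semilinear conjugation -/

omit [ValuativeRel E] [TopologicalSpace E] [IsNonarchimedeanLocalField E] in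
/-- If `σ' ∘ φ = φ ∘ σ` then also `σ'⁻¹ ∘ φ = φ ∘ σ⁻¹`. [folklore] -/
private theorem inv_smul_semilinear {φ : AlgebraicClosure E ≃+* AlgebraicClosure E}
    {σ σ' : absoluteGaloisGroup E} (h : ∀ z, σ' • φ z = φ (σ • z)) (z : AlgebraicClosure E) :
    σ'⁻¹ • φ z = φ (σ⁻¹ • z) := by
  rw [inv_smul_eq_iff, h, smul_inv_smul]

/-- **Frobenius powers are preserved by semilinear conjugation.**  If `φ` preserves `S` (both
ways, hence `𝔓`) and `σ' ∘ φ = φ ∘ σ` on `Ē`, then `IsFrobPow σ n → IsFrobPow σ' n`: for `x ∈ S`,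
`σ' x - x^{qⁿ} = φ (σ y - y^{qⁿ})` with `y = φ⁻¹ x ∈ S`.  In particular conjugation by `φ`
preserves the inertia group, the Weil group and the degree. [cite: NeukirchANT1999, Ch. IV Prop. (5.8)] -/
theorem isFrobPow_of_semilinear_conj {φ : AlgebraicClosure E ≃+* AlgebraicClosure E}
    (hS : ∀ y ∈ absIntegers 𝒪[E] E, φ y ∈ absIntegers 𝒪[E] E)
    (hS' : ∀ y ∈ absIntegers 𝒪[E] E, φ.symm y ∈ absIntegers 𝒪[E] E)
    {σ σ' : absoluteGaloisGroup E} (h : ∀ z, σ' • φ z = φ (σ • z)) {n : ℤ}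
    (hσ : IsFrobPow σ n) : IsFrobPow σ' n := by
  have hP := map_mem_absMaximalIdeal hS hS'
  -- the common computation: `φ (τ • y - y ^ m) = τ' • x - x ^ m` for `y = φ⁻¹ x`
  have key : ∀ {τ τ' : absoluteGaloisGroup E}, (∀ z, τ' • φ z = φ (τ • z)) →
      ∀ (m : ℕ) (x : absIntegers 𝒪[E] E),
        τ • (⟨φ.symm (x : AlgebraicClosure E), hS' _ x.2⟩ : absIntegers 𝒪[E] E) -
            (⟨φ.symm (x : AlgebraicClosure E), hS' _ x.2⟩ : absIntegers 𝒪[E] E) ^ m ∈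
              absMaximalIdeal E →
          τ' • x - x ^ m ∈ absMaximalIdeal E := by
    intro τ τ' hτ m x hx
    set y : absIntegers 𝒪[E] E := ⟨φ.symm (x : AlgebraicClosure E), hS' _ x.2⟩ with hy
    have h1 := hP (τ • y - y ^ m) hx
    have h2 : (⟨φ ((τ • y - y ^ m : absIntegers 𝒪[E] E) : AlgebraicClosure E),
        hS _ (τ • y - y ^ m).2⟩ : absIntegers 𝒪[E] E) = τ' • x - x ^ m := by
      apply Subtype.ext
      change φ ((τ • y - y ^ m : absIntegers 𝒪[E] E) : AlgebraicClosure E) =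
        ((τ' • x - x ^ m : absIntegers 𝒪[E] E) : AlgebraicClosure E)
      rw [AddSubgroupClass.coe_sub, SubmonoidClass.coe_pow, integralClosure.coe_smul,
        AddSubgroupClass.coe_sub, SubmonoidClass.coe_pow, integralClosure.coe_smul, map_sub, map_pow,
        hy, ← hτ, φ.apply_symm_apply]
    rw [h2] at h1
    exact h1
  rcases Int.eq_nat_or_neg n with ⟨m, rfl | rfl⟩
  · rw [isFrobPow_natCast_iff] at hσ ⊢
    intro x
    exact key h (residueFieldCard E ^ m) x (hσ _)
  · rcases m with _ | m
    · simp only [Nat.cast_zero, neg_zero] at hσ ⊢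
      rw [show (0 : ℤ) = ((0 : ℕ) : ℤ) from rfl, isFrobPow_natCast_iff] at hσ ⊢
      intro x
      exact key h (residueFieldCard E ^ 0) x (hσ _)
    · rw [show (-((m + 1 : ℕ) : ℤ)) = Int.negSucc m from rfl, isFrobPow_negSucc_iff] at hσ ⊢
      intro x
      exact key (inv_smul_semilinear h) (residueFieldCard E ^ (m + 1)) x (hσ _)

end Valued

/-! ### Conjugation by `φ` as a topological automorphism of `G_E` -/

section Conj

variable {E : Type u} [Field E]

/-- An automorphism over `E` fixing a set `t` pointwise fixes `E(t)` pointwise. [folklore] -/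
private theorem mem_fixingSubgroup_adjoin_iff' {N : Type*} [Field N] [Algebra E N]
    (t : Set N) (ψ : N ≃ₐ[E] N) :
    ψ ∈ (IntermediateField.adjoin E t).fixingSubgroup ↔ ∀ x ∈ t, ψ x = x := by
  rw [IntermediateField.mem_fixingSubgroup_iff]
  refine ⟨fun h x hx => h x (IntermediateField.subset_adjoin E t hx), fun h x hx => ?_⟩
  induction hx using IntermediateField.adjoin_induction with
  | mem x hx => exact h x hx
  | algebraMap c => exact ψ.commutes c
  | add x y _ _ hx hy => rw [map_add, hx, hy]
  | inv x _ hx => rw [map_inv₀, hx]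
  | mul x y _ _ hx hy => rw [map_mul, hx, hy]

/-- The inverse of a `γ`-semilinear `φ` is `γ⁻¹`-semilinear. [folklore] -/
private theorem symm_semilinear {γ : E ≃+* E} {φ : AlgebraicClosure E ≃+* AlgebraicClosure E}
    (hφ : ∀ x : E, φ (algebraMap E (AlgebraicClosure E) x) = algebraMap E (AlgebraicClosure E) (γ x))
    (x : E) : φ.symm (algebraMap E (AlgebraicClosure E) x) =
      algebraMap E (AlgebraicClosure E) (γ.symm x) := by
  apply φ.injective
  rw [φ.apply_symm_apply, hφ, γ.apply_symm_apply]

/-- Conjugation `σ ↦ φ ∘ σ ∘ φ⁻¹` by a `γ`-semilinear ring automorphism `φ` of `Ē` is a group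
automorphism of `Gal(Ē/E)` (as `E`-algebra automorphisms); existence form with the defining
formula. [cite: NeukirchANT1999, Ch. IV §1] -/
theorem exists_mulEquiv_semilinear_conj {γ : E ≃+* E} (φ : AlgebraicClosure E ≃+* AlgebraicClosure E)
    (hφ : ∀ x : E, φ (algebraMap E (AlgebraicClosure E) x) = algebraMap E (AlgebraicClosure E) (γ x)) :
    ∃ c : (AlgebraicClosure E ≃ₐ[E] AlgebraicClosure E) ≃* (AlgebraicClosure E ≃ₐ[E] AlgebraicClosure E),
      (∀ σ z, c σ (φ z) = φ (σ z)) ∧ (∀ τ z, c.symm τ (φ.symm z) = φ.symm (τ z)) := by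
  have hφ' := symm_semilinear hφ
  -- conjugation by `φ` and by `φ⁻¹`, as functions on `Gal(Ē/E)`
  let c₁ : (AlgebraicClosure E ≃ₐ[E] AlgebraicClosure E) → (AlgebraicClosure E ≃ₐ[E] AlgebraicClosure E) :=
    fun σ => AlgEquiv.ofRingEquiv (f := φ.symm.trans (σ.toRingEquiv.trans φ)) (by
      intro x
      change φ (σ (φ.symm (algebraMap E (AlgebraicClosure E) x))) = _
      rw [hφ', AlgEquiv.commutes, hφ, γ.apply_symm_apply])
  let c₂ : (AlgebraicClosure E ≃ₐ[E] AlgebraicClosure E) → (AlgebraicClosure E ≃ₐ[E] AlgebraicClosure E) :=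
    fun τ => AlgEquiv.ofRingEquiv (f := φ.trans (τ.toRingEquiv.trans φ.symm)) (by
      intro x
      change φ.symm (τ (φ (algebraMap E (AlgebraicClosure E) x))) = _
      rw [hφ, AlgEquiv.commutes, hφ', γ.symm_apply_apply])
  have c₁_apply : ∀ σ z, c₁ σ z = φ (σ (φ.symm z)) := fun _ _ => rfl
  have c₂_apply : ∀ τ z, c₂ τ z = φ.symm (τ (φ z)) := fun _ _ => rfl
  let c : (AlgebraicClosure E ≃ₐ[E] AlgebraicClosure E) ≃* (AlgebraicClosure E ≃ₐ[E] AlgebraicClosure E) :=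
    { toFun := c₁,
      invFun := c₂,
      left_inv := fun σ => by
        ext z
        rw [c₂_apply, c₁_apply, φ.symm_apply_apply, φ.symm_apply_apply],
      right_inv := fun τ => by
        ext z
        rw [c₁_apply, c₂_apply, φ.apply_symm_apply, φ.apply_symm_apply],
      map_mul' := fun σ τ => by
        ext z
        rw [AlgEquiv.mul_apply, c₁_apply, c₁_apply, c₁_apply, AlgEquiv.mul_apply,
          φ.symm_apply_apply] }
  refine ⟨c, fun σ z => ?_, fun τ z => ?_⟩
  · change c₁ σ (φ z) = φ (σ z)
    rw [c₁_apply, φ.symm_apply_apply]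
  · change c₂ τ (φ.symm z) = φ.symm (τ z)
    rw [c₂_apply, φ.apply_symm_apply]

/-- A finite-dimensional intermediate field is finitely generated. [folklore] -/
private theorem fg_of_finiteDimensional' {B N : Type*} [Field B] [Field N] [Algebra B N]
    (M : IntermediateField B N) [FiniteDimensional B M] : M.FG :=
  IntermediateField.essFiniteType_iff.mp inferInstance

/-- Krull continuity of semilinear conjugation: if `c σ ∘ φ = φ ∘ σ` for all `σ` then `c` is
continuous (a basic neighbourhood `Gal(Ē/E(t))`, `t` finite, contains the image of
`Gal(Ē/E(φ⁻¹ t))`). [cite: NeukirchANT1999, Ch. IV §1] -/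
theorem continuous_of_semilinear_conj (φ : AlgebraicClosure E ≃+* AlgebraicClosure E)
    (c : (AlgebraicClosure E ≃ₐ[E] AlgebraicClosure E) ≃* (AlgebraicClosure E ≃ₐ[E] AlgebraicClosure E))
    (hc : ∀ σ z, c σ (φ z) = φ (σ z)) : Continuous c := by
  apply continuous_of_continuousAt_one _ (continuousAt_def.mpr _)
  intro s hs
  rw [map_one] at hs
  obtain ⟨M, hMfin, hMs⟩ := (krullTopology_mem_nhds_one_iff E (AlgebraicClosure E) s).mp hs
  haveI := hMfin
  obtain ⟨t, ht⟩ := fg_of_finiteDimensional' M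
  set M₀ : IntermediateField E (AlgebraicClosure E) :=
    IntermediateField.adjoin E ((fun y => φ.symm y) '' (t : Set (AlgebraicClosure E))) with hM₀
  haveI : FiniteDimensional E M₀ :=
    IntermediateField.finiteDimensional_adjoin fun x _ => Algebra.IsIntegral.isIntegral x
  have hU : (M₀.fixingSubgroup : Set (AlgebraicClosure E ≃ₐ[E] AlgebraicClosure E)) ∈
      𝓝 (1 : AlgebraicClosure E ≃ₐ[E] AlgebraicClosure E) :=
    M₀.fixingSubgroup_isOpen.mem_nhds (one_mem _)
  refine Filter.mem_of_superset hU fun σ hσ => ?_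
  rw [SetLike.mem_coe, IntermediateField.mem_fixingSubgroup_iff] at hσ
  rw [Set.mem_preimage]
  apply hMs
  rw [SetLike.mem_coe, ← ht, mem_fixingSubgroup_adjoin_iff']
  intro y hy
  have := hc σ (φ.symm y)
  rw [φ.apply_symm_apply] at this
  rw [this, hσ _ (IntermediateField.subset_adjoin E _ ⟨y, hy, rfl⟩), φ.apply_symm_apply]

/-- **Conjugation by `φ` is a topological automorphism of `G_E`.**  For a `γ`-semilinear ring
automorphism `φ` of `Ē` there is `c : G_E ≃ₜ* G_E` with `c σ ∘ φ = φ ∘ σ` on `Ē` (namely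
`c σ = φ σ φ⁻¹`).  [cite: NeukirchANT1999, Ch. IV §1] -/
theorem exists_continuousMulEquiv_semilinear_conj {γ : E ≃+* E}
    (φ : AlgebraicClosure E ≃+* AlgebraicClosure E)
    (hφ : ∀ x : E, φ (algebraMap E (AlgebraicClosure E) x) = algebraMap E (AlgebraicClosure E) (γ x)) :
    ∃ c : absoluteGaloisGroup E ≃ₜ* absoluteGaloisGroup E, ∀ σ z, c σ • φ z = φ (σ • z) := by
  obtain ⟨c, hc, hc'⟩ := exists_mulEquiv_semilinear_conj φ hφ
  have h1 : Continuous c := continuous_of_semilinear_conj φ c hc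
  have h2 : Continuous c.symm := continuous_of_semilinear_conj φ.symm c.symm hc'
  refine ⟨{ toMulEquiv := ((absoluteGaloisGroup.toAlgEquiv E).trans c).trans
              (absoluteGaloisGroup.toAlgEquiv E).symm
            continuous_toFun := h1
            continuous_invFun := h2 }, fun σ z => ?_⟩
  exact hc _ z

end Conj

end Literature.AnabelianGeometry.AbsoluteAnabelian
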